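import Summits.NavierStokesRegularity.NavierStokesRegularity.Theorems.FrozenSignCascadeBoundedEnvelopeContinuationMorreyOfEnvelope
import Literature.Analysis.FluidPDE.LerayHeatTest
import Literature.Analysis.FluidPDE.NSFourierSobolev
import HarnessLib

/-!
# Route FrozenSignCascade · crux `BoundedEnvelopeContinuation` — the pseudo-measure (PM²) dual bound
# of an envelope-bounded synthesized velocity

Helper file for the crux item stmt-NavierStokesRegularity-10579 (`BoundedEnvelopeContinuation`,
conjunct (B) of route `FrozenSignCascade`), line `registered`; lands `--supports` that item
(registered sub-goal `pm_dual_of_envelope`; lead c4, reshape r4: the zoom limit inherits the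
full pseudo-measure bound, not only its Morrey shadow).

For a continuous, polynomially decaying coefficient field `f` on `ℝ³` with
critical envelope `‖ξ‖² ‖f ξ‖ ≤ C`, the synthesized velocity `u = synthVel f = Re 𝓕 f` satisfies
the DUAL form of the `PM²` bound: for every real test function `φ` with `φ`, `𝓕φ` and
`‖𝓕φ‖/‖ξ‖²` integrable, `|∫ u_l φ| ≤ C ∫ ‖𝓕φ(ξ)‖ / ‖ξ‖² dξ` (self-adjointness of `𝓕`,
`abs_integral_synthVel_mul_le`); the dual bound is translation invariant and critical under the
Navier–Stokes zoom (`pm_dual_zoom`: constant `(a/λ) C` for `y ↦ a u(x₀ + λ y)`), and stable under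
bounded pointwise limits (`pm_dual_of_tendsto`, dominated convergence). These are the three steps by
which the KNSS record-zoom limit of the line inherits the `PM²` bound of the flow (Le Jan–Sznitman /
Cannone–Karch pseudo-measure space, Lemarié-Rieusset 2016 §8.5), cf. the composition file
`…OfLiouvillePM.lean`.

References: P. G. Lemarié-Rieusset, *The Navier–Stokes problem in the 21st century* (2016), §8.5;
M. Cannone, G. Karch, J. Differential Equations 197 (2004), §2; folklore.
-/

noncomputable section

set_option linter.dupNamespace false -- nested layout Summit.<S>.<Sub>, Sub = S (D-0017)

open MeasureTheory Set Metric Real Filter Topology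
open scoped FourierTransform RealInnerProductSpace ENNReal
open Literature.Analysis.FluidPDE Literature.Analysis.FluidPDE.FourierNS

namespace Summit.NavierStokesRegularity.NavierStokesRegularity.Theorems.BoundedEnvelope


/-- **The `PM²` dual bound of an envelope-bounded coefficient field, complex form.** If `g : ℝ³ → ℂ`
is integrable with `‖ξ‖² ‖g ξ‖ ≤ C`, then for every integrable `φ : ℝ³ → ℂ` with `𝓕 φ` integrable
and `ξ ↦ ‖𝓕 φ ξ‖ / ‖ξ‖²` integrable, `‖∫ 𝓕 g · φ‖ ≤ C ∫ ‖𝓕 φ ξ‖ / ‖ξ‖² dξ` (multiplication formula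
`∫ 𝓕 g · φ = ∫ g · 𝓕 φ`, then the pointwise envelope off the null set `{0}`). [folklore] -/
theorem norm_integral_fourier_mul_le {g : (EuclideanSpace ℝ (Fin 3)) → ℂ} {C : ℝ} (hg : Integrable g)
    (henv : ∀ ξ, ‖ξ‖ ^ 2 * ‖g ξ‖ ≤ C) {φ : (EuclideanSpace ℝ (Fin 3)) → ℂ} (hφ : Integrable φ)
    (hJ : Integrable (fun ξ : (EuclideanSpace ℝ (Fin 3)) => ‖𝓕 φ ξ‖ / ‖ξ‖ ^ 2)) :
    ‖∫ x, 𝓕 g x * φ x‖ ≤ C * ∫ ξ, ‖𝓕 φ ξ‖ / ‖ξ‖ ^ 2 := by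
  rw [← integral_mul_fourier_eq hg hφ, ← integral_const_mul]
  have hFc : Continuous (𝓕 φ) :=
    VectorFourier.fourierIntegral_continuous Real.continuous_fourierChar
      (by exact continuous_inner) hφ
  -- the pointwise bound off the origin (a null set)
  have hae : ∀ᵐ ξ : (EuclideanSpace ℝ (Fin 3)) ∂volume, ‖g ξ * 𝓕 φ ξ‖ ≤ C * (‖𝓕 φ ξ‖ / ‖ξ‖ ^ 2) := by
    have h0 : ∀ᵐ ξ : (EuclideanSpace ℝ (Fin 3)) ∂volume, ξ ≠ 0 := by
      have : volume ({0} : Set (EuclideanSpace ℝ (Fin 3))) = 0 := measure_singleton 0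
      simpa only [Set.mem_singleton_iff] using measure_eq_zero_iff_ae_notMem.1 this
    filter_upwards [h0] with ξ hξ
    have hξ' : 0 < ‖ξ‖ ^ 2 := by positivity
    rw [norm_mul, mul_div_assoc', le_div_iff₀ hξ']
    calc ‖g ξ‖ * ‖𝓕 φ ξ‖ * ‖ξ‖ ^ 2 = ‖ξ‖ ^ 2 * ‖g ξ‖ * ‖𝓕 φ ξ‖ := by ring
      _ ≤ C * ‖𝓕 φ ξ‖ := mul_le_mul_of_nonneg_right (henv ξ) (norm_nonneg _)
  -- integrability of `‖g · 𝓕φ‖` by domination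
  have hint : Integrable (fun ξ : (EuclideanSpace ℝ (Fin 3)) => ‖g ξ * 𝓕 φ ξ‖) := by
    refine Integrable.mono' (hJ.const_mul C) (hg.aestronglyMeasurable.mul hFc.aestronglyMeasurable).norm ?_
    filter_upwards [hae] with ξ hξ
    rw [Real.norm_eq_abs, abs_of_nonneg (norm_nonneg _)]
    exact hξ
  refine (norm_integral_le_integral_norm _).trans ?_
  exact integral_mono_ae hint (hJ.const_mul C) hae

/-- **The `PM²` dual bound of an envelope-bounded synthesized velocity** (real test functions).
For a continuous coefficient field `f` with decay of every order and critical envelope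
`‖ξ‖² ‖f ξ‖ ≤ C`, each component of `u = synthVel f = Re 𝓕 f` satisfies
`|∫ u_l φ| ≤ C ∫ ‖𝓕φ(ξ)‖ / ‖ξ‖² dξ` for every integrable real `φ` whose (complexified) Fourier
transform has `‖𝓕φ‖/‖ξ‖²` integrable. [folklore] -/
theorem abs_integral_synthVel_mul_le {C : ℝ} {f : (EuclideanSpace ℝ (Fin 3)) → Fin 3 → ℂ} (hf : Continuous f)
    (hdec : ∀ K : ℕ, ∃ B : ℝ, HasDecay K B f) (henv : ∀ ξ : (EuclideanSpace ℝ (Fin 3)), ‖ξ‖ ^ 2 * ‖f ξ‖ ≤ C)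
    (l : Fin 3) {φ : (EuclideanSpace ℝ (Fin 3)) → ℝ} (hφ : Integrable φ)
    (hJ : Integrable (fun ξ : (EuclideanSpace ℝ (Fin 3)) => ‖𝓕 (fun x => (φ x : ℂ)) ξ‖ / ‖ξ‖ ^ 2)) :
    |∫ x, synthVel f x l * φ x| ≤ C * ∫ ξ, ‖𝓕 (fun x => (φ x : ℂ)) ξ‖ / ‖ξ‖ ^ 2 := by
  set g : (EuclideanSpace ℝ (Fin 3)) → ℂ := fun ξ => f ξ l with hgdef
  have hgc : Continuous g := (continuous_apply l).comp hf
  obtain ⟨B, hB⟩ := hdec 4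
  have hgdec : HasDecay 4 B g := fun ξ => (norm_le_pi_norm (f ξ) l).trans (hB ξ)
  have h3 : Fintype.card (Fin 3) < 4 := by simp
  have hgi : Integrable g := hgdec.integrable (finrank_lt_of_card_lt h3) hgc.aestronglyMeasurable
  have hgenv : ∀ ξ : (EuclideanSpace ℝ (Fin 3)), ‖ξ‖ ^ 2 * ‖g ξ‖ ≤ C := fun ξ =>
    (mul_le_mul_of_nonneg_left (norm_le_pi_norm (f ξ) l) (by positivity)).trans (henv ξ)
  have hφc : Integrable (fun x : (EuclideanSpace ℝ (Fin 3)) => (φ x : ℂ)) := hφ.ofReal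
  -- the complex pairing and its real part
  have hFc : Continuous (𝓕 g) :=
    VectorFourier.fourierIntegral_continuous Real.continuous_fourierChar
      (by exact continuous_inner) hgi
  obtain ⟨M, hM⟩ : ∃ M, ∀ x, ‖𝓕 g x‖ ≤ M :=
    ⟨∫ ξ, ‖g ξ‖, fun x => VectorFourier.norm_fourierIntegral_le_integral_norm _ _ _ _ _⟩
  have hprod : Integrable (fun x : (EuclideanSpace ℝ (Fin 3)) => 𝓕 g x * (φ x : ℂ)) :=
    hφc.bdd_mul hFc.aestronglyMeasurable (Eventually.of_forall hM)
  have hre : ∫ x, synthVel f x l * φ x = (∫ x, 𝓕 g x * (φ x : ℂ)).re := by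
    rw [show (∫ x, 𝓕 g x * (φ x : ℂ)).re = RCLike.re (∫ x, 𝓕 g x * (φ x : ℂ)) from rfl,
      ← integral_re hprod]
    refine integral_congr_ae (Eventually.of_forall fun x => ?_)
    simp [synthVel_apply, hgdef]
  rw [hre]
  exact (Complex.abs_re_le_norm _).trans (norm_integral_fourier_mul_le hgi hgenv hφc hJ)

/-! ### Translation–dilation covariance of the dual bound -/

/-- **Fourier transform of a translated dilate, in norm**: for `lam > 0`,
`‖𝓕 (x ↦ g (lam⁻¹ (x - x₀))) ξ‖ = lam³ ‖𝓕 g (lam ξ)‖` on `ℝ³` (substitute `x = x₀ + lam y`; the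
translation contributes a unimodular phase). [folklore] -/
theorem norm_fourier_comp_dilate_translate (g : (EuclideanSpace ℝ (Fin 3)) → ℂ) {lam : ℝ} (hlam : 0 < lam) (x₀ ξ : (EuclideanSpace ℝ (Fin 3))) :
    ‖𝓕 (fun x => g (lam⁻¹ • (x - x₀))) ξ‖ = lam ^ 3 * ‖𝓕 g (lam • ξ)‖ := by
  rw [fourier_eq, fourier_eq]
  -- translate
  have h1 : ∫ v : (EuclideanSpace ℝ (Fin 3)), 𝐞 (-⟪v, ξ⟫) • g (lam⁻¹ • (v - x₀)) =
      ∫ w : (EuclideanSpace ℝ (Fin 3)), 𝐞 (-⟪w + x₀, ξ⟫) • g (lam⁻¹ • w) := by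
    rw [← integral_add_right_eq_self (fun w : (EuclideanSpace ℝ (Fin 3)) => 𝐞 (-⟪w + x₀, ξ⟫) • g (lam⁻¹ • w)) (-x₀)]
    refine integral_congr_ae (Eventually.of_forall fun v => ?_)
    simp [sub_eq_add_neg]
  -- split the character and dilate
  have h2 : (fun w : (EuclideanSpace ℝ (Fin 3)) => 𝐞 (-⟪w + x₀, ξ⟫) • g (lam⁻¹ • w)) =
      fun w : (EuclideanSpace ℝ (Fin 3)) => (𝐞 (-⟪x₀, ξ⟫) : ℂ) • ((fun y : (EuclideanSpace ℝ (Fin 3)) => 𝐞 (-⟪y, lam • ξ⟫) • g y) (lam⁻¹ • w)) := by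
    funext w
    have hinner : ⟪w + x₀, ξ⟫ = ⟪lam⁻¹ • w, lam • ξ⟫ + ⟪x₀, ξ⟫ := by
      rw [inner_add_left, real_inner_smul_left, real_inner_smul_right, ← mul_assoc,
        inv_mul_cancel₀ hlam.ne', one_mul]
    simp only [Circle.smul_def, smul_eq_mul]
    rw [hinner, neg_add, AddChar.map_add_eq_mul, Circle.coe_mul]
    ring
  rw [h1, h2, integral_smul, Measure.integral_comp_inv_smul_of_nonneg (volume : Measure (EuclideanSpace ℝ (Fin 3)))
      (fun y : (EuclideanSpace ℝ (Fin 3)) => 𝐞 (-⟪y, lam • ξ⟫) • g y) hlam.le, norm_smul,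
    Circle.norm_coe, one_mul, finrank_euclideanSpace_fin, norm_smul, Real.norm_of_nonneg
    (pow_nonneg hlam.le 3)]

/-- **Scaling of the dual `PM²` functional**: `∫ ‖𝓕ψ‖/‖ξ‖² = lam² ∫ ‖𝓕φ‖/‖ξ‖²` for the translated
dilate `ψ = φ(lam⁻¹(· - x₀))`, `lam > 0`, and integrability transfers. [folklore] -/
theorem integral_dual_comp_dilate_translate (g : (EuclideanSpace ℝ (Fin 3)) → ℂ) {lam : ℝ} (hlam : 0 < lam) (x₀ : (EuclideanSpace ℝ (Fin 3))) :
    (∫ ξ : (EuclideanSpace ℝ (Fin 3)), ‖𝓕 (fun x => g (lam⁻¹ • (x - x₀))) ξ‖ / ‖ξ‖ ^ 2) =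
        lam ^ 2 * ∫ ξ : (EuclideanSpace ℝ (Fin 3)), ‖𝓕 g ξ‖ / ‖ξ‖ ^ 2 := by
  have hkey : (fun ξ : (EuclideanSpace ℝ (Fin 3)) => ‖𝓕 (fun x => g (lam⁻¹ • (x - x₀))) ξ‖ / ‖ξ‖ ^ 2) =
      fun ξ : (EuclideanSpace ℝ (Fin 3)) => lam ^ 5 * ((fun η : (EuclideanSpace ℝ (Fin 3)) => ‖𝓕 g η‖ / ‖η‖ ^ 2) (lam • ξ)) := by
    funext ξ
    rw [norm_fourier_comp_dilate_translate g hlam x₀ ξ]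
    simp only [norm_smul, Real.norm_of_nonneg hlam.le]
    by_cases hξ : ‖ξ‖ = 0
    · simp [hξ]
    · field_simp
  rw [hkey, integral_const_mul, Measure.integral_comp_smul_of_nonneg (volume : Measure (EuclideanSpace ℝ (Fin 3)))
      (fun η : (EuclideanSpace ℝ (Fin 3)) => ‖𝓕 g η‖ / ‖η‖ ^ 2) lam (hR := hlam.le),
    finrank_euclideanSpace_fin, smul_eq_mul]
  field_simp

/-- Integrability of the dual functional of the translated dilate. [folklore] -/
theorem integrable_dual_comp_dilate_translate (g : (EuclideanSpace ℝ (Fin 3)) → ℂ) {lam : ℝ} (hlam : 0 < lam) (x₀ : (EuclideanSpace ℝ (Fin 3)))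
    (hJ : Integrable (fun ξ : (EuclideanSpace ℝ (Fin 3)) => ‖𝓕 g ξ‖ / ‖ξ‖ ^ 2)) :
    Integrable (fun ξ : (EuclideanSpace ℝ (Fin 3)) => ‖𝓕 (fun x => g (lam⁻¹ • (x - x₀))) ξ‖ / ‖ξ‖ ^ 2) := by
  have hkey : (fun ξ : (EuclideanSpace ℝ (Fin 3)) => ‖𝓕 (fun x => g (lam⁻¹ • (x - x₀))) ξ‖ / ‖ξ‖ ^ 2) =
      fun ξ : (EuclideanSpace ℝ (Fin 3)) => lam ^ 5 * ((fun η : (EuclideanSpace ℝ (Fin 3)) => ‖𝓕 g η‖ / ‖η‖ ^ 2) (lam • ξ)) := by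
    funext ξ
    rw [norm_fourier_comp_dilate_translate g hlam x₀ ξ]
    simp only [norm_smul, Real.norm_of_nonneg hlam.le]
    by_cases hξ : ‖ξ‖ = 0
    · simp [hξ]
    · field_simp
  rw [hkey]
  exact ((integrable_comp_smul_iff volume (fun η : (EuclideanSpace ℝ (Fin 3)) => ‖𝓕 g η‖ / ‖η‖ ^ 2) hlam.ne').2 hJ).const_mul _

/-- **Translation–dilation covariance of the dual `PM²` bound.** If every component of
`u : ℝ³ → ℝ³` obeys `|∫ u_l φ| ≤ C ∫ ‖𝓕φ‖/‖ξ‖²` for all admissible real `φ`, then the zoomed field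
`y ↦ a u(x₀ + lam y)` (`a ≥ 0`, `lam > 0`) obeys the same bound with constant `(a/lam) C` — the dual
`PM²` norm is critical (scale invariant for `a = lam`) and translation invariant. [folklore] -/
theorem pm_dual_zoom {u : (EuclideanSpace ℝ (Fin 3)) → (EuclideanSpace ℝ (Fin 3))} {C : ℝ}
    (hPM : ∀ (l : Fin 3) (φ : (EuclideanSpace ℝ (Fin 3)) → ℝ), Integrable φ →
      Integrable (fun ξ : (EuclideanSpace ℝ (Fin 3)) => ‖𝓕 (fun x => (φ x : ℂ)) ξ‖ / ‖ξ‖ ^ 2) →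
      |∫ x, u x l * φ x| ≤ C * ∫ ξ, ‖𝓕 (fun x => (φ x : ℂ)) ξ‖ / ‖ξ‖ ^ 2)
    {a lam : ℝ} (ha : 0 ≤ a) (hlam : 0 < lam) (x₀ : (EuclideanSpace ℝ (Fin 3))) (l : Fin 3) {φ : (EuclideanSpace ℝ (Fin 3)) → ℝ}
    (hφ : Integrable φ) (hJ : Integrable (fun ξ : (EuclideanSpace ℝ (Fin 3)) => ‖𝓕 (fun x => (φ x : ℂ)) ξ‖ / ‖ξ‖ ^ 2)) :
    |∫ y, (a • u (x₀ + lam • y)) l * φ y| ≤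
      a / lam * C * ∫ ξ, ‖𝓕 (fun x => (φ x : ℂ)) ξ‖ / ‖ξ‖ ^ 2 := by
  -- the zoomed test function `ψ = φ (lam⁻¹ (· - x₀))` and its data
  have hψi : Integrable (fun x : (EuclideanSpace ℝ (Fin 3)) => φ (lam⁻¹ • (x - x₀))) :=
    (hφ.comp_smul (inv_ne_zero hlam.ne')).comp_sub_right x₀
  have hJψ : Integrable (fun ξ : (EuclideanSpace ℝ (Fin 3)) =>
      ‖𝓕 (fun x => ((φ (lam⁻¹ • (x - x₀)) : ℝ) : ℂ)) ξ‖ / ‖ξ‖ ^ 2) :=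
    integrable_dual_comp_dilate_translate (fun y => (φ y : ℂ)) hlam x₀ hJ
  have hJeq : (∫ ξ : (EuclideanSpace ℝ (Fin 3)), ‖𝓕 (fun x => ((φ (lam⁻¹ • (x - x₀)) : ℝ) : ℂ)) ξ‖ / ‖ξ‖ ^ 2) =
      lam ^ 2 * ∫ ξ, ‖𝓕 (fun x => (φ x : ℂ)) ξ‖ / ‖ξ‖ ^ 2 :=
    integral_dual_comp_dilate_translate (fun y => (φ y : ℂ)) hlam x₀
  have key := hPM l (fun x : (EuclideanSpace ℝ (Fin 3)) => φ (lam⁻¹ • (x - x₀))) hψi hJψ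
  rw [hJeq] at key
  -- change of variables in the pairing
  have e1 : ∀ y : (EuclideanSpace ℝ (Fin 3)), (a • u (x₀ + lam • y)) l * φ y =
      a * ((fun w : (EuclideanSpace ℝ (Fin 3)) => u (x₀ + w) l * φ (lam⁻¹ • w)) (lam • y)) := by
    intro y
    dsimp only
    rw [inv_smul_smul₀ hlam.ne', PiLp.smul_apply, smul_eq_mul, mul_assoc]
  have e2 : ∫ w : (EuclideanSpace ℝ (Fin 3)), u (x₀ + w) l * φ (lam⁻¹ • w) = ∫ x : (EuclideanSpace ℝ (Fin 3)), u x l * φ (lam⁻¹ • (x - x₀)) := by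
    rw [← integral_sub_right_eq_self (fun w : (EuclideanSpace ℝ (Fin 3)) => u (x₀ + w) l * φ (lam⁻¹ • w)) x₀]
    refine integral_congr_ae (Eventually.of_forall fun x => ?_)
    dsimp only
    rw [add_sub_cancel]
  have hcv : ∫ y, (a • u (x₀ + lam • y)) l * φ y =
      a * ((lam ^ 3)⁻¹ * ∫ x : (EuclideanSpace ℝ (Fin 3)), u x l * φ (lam⁻¹ • (x - x₀))) := by
    rw [integral_congr_ae (Eventually.of_forall e1), integral_const_mul,
      Measure.integral_comp_smul_of_nonneg (volume : Measure (EuclideanSpace ℝ (Fin 3)))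
        (fun w : (EuclideanSpace ℝ (Fin 3)) => u (x₀ + w) l * φ (lam⁻¹ • w)) lam (hR := hlam.le),
      finrank_euclideanSpace_fin, smul_eq_mul, e2]
  rw [hcv, abs_mul, abs_mul, abs_of_nonneg ha, abs_of_nonneg (by positivity : (0:ℝ) ≤ (lam ^ 3)⁻¹)]
  set J : ℝ := ∫ ξ, ‖𝓕 (fun x => (φ x : ℂ)) ξ‖ / ‖ξ‖ ^ 2 with hJdef
  have hl3 : (lam ^ 3)⁻¹ * (C * (lam ^ 2 * J)) = lam⁻¹ * C * J := by
    field_simp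
  calc a * ((lam ^ 3)⁻¹ * |∫ x : (EuclideanSpace ℝ (Fin 3)), u x l * φ (lam⁻¹ • (x - x₀))|)
      ≤ a * ((lam ^ 3)⁻¹ * (C * (lam ^ 2 * J))) :=
        mul_le_mul_of_nonneg_left (mul_le_mul_of_nonneg_left key (by positivity)) ha
    _ = a / lam * C * J := by rw [hl3, div_eq_mul_inv]; ring

/-! ### Stability of the dual bound under bounded pointwise limits -/

/-- **The dual `PM²` bound passes to bounded pointwise limits** (dominated convergence): if
`z n → v` pointwise on `ℝ³`, the `z n` are a.e.-strongly measurable and eventually bounded by `2`,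
and eventually every `z n` obeys the dual bound with constant `C`, then so does `v`. [folklore] -/
theorem pm_dual_of_tendsto {z : ℕ → (EuclideanSpace ℝ (Fin 3)) → (EuclideanSpace ℝ (Fin 3))} {v : (EuclideanSpace ℝ (Fin 3)) → (EuclideanSpace ℝ (Fin 3))} {C : ℝ}
    (hpt : ∀ y, Tendsto (fun n => z n y) atTop (𝓝 (v y)))
    (hmeas : ∀ᶠ n in atTop, AEStronglyMeasurable (z n) volume)
    (hbd : ∀ᶠ n in atTop, ∀ y, ‖z n y‖ ≤ 2)
    (hPMn : ∀ᶠ n in atTop, ∀ (l : Fin 3) (φ : (EuclideanSpace ℝ (Fin 3)) → ℝ), Integrable φ →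
      Integrable (fun ξ : (EuclideanSpace ℝ (Fin 3)) => ‖𝓕 (fun x => (φ x : ℂ)) ξ‖ / ‖ξ‖ ^ 2) →
      |∫ y, z n y l * φ y| ≤ C * ∫ ξ, ‖𝓕 (fun x => (φ x : ℂ)) ξ‖ / ‖ξ‖ ^ 2)
    (l : Fin 3) {φ : (EuclideanSpace ℝ (Fin 3)) → ℝ} (hφ : Integrable φ)
    (hJ : Integrable (fun ξ : (EuclideanSpace ℝ (Fin 3)) => ‖𝓕 (fun x => (φ x : ℂ)) ξ‖ / ‖ξ‖ ^ 2)) :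
    |∫ y, v y l * φ y| ≤ C * ∫ ξ, ‖𝓕 (fun x => (φ x : ℂ)) ξ‖ / ‖ξ‖ ^ 2 := by
  -- dominated convergence for `F n y = (z n y)_l φ(y)`
  have hlim : Tendsto (fun n => ∫ y, z n y l * φ y) atTop (𝓝 (∫ y, v y l * φ y)) := by
    refine tendsto_integral_filter_of_dominated_convergence (fun y => 2 * ‖φ y‖) ?_ ?_ ?_ ?_
    · filter_upwards [hmeas] with n hn
      have hcoord : AEStronglyMeasurable (fun y => z n y l) volume :=
        (EuclideanSpace.proj l).continuous.comp_aestronglyMeasurable hn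
      exact hcoord.mul hφ.aestronglyMeasurable
    · filter_upwards [hbd] with n hn
      refine Eventually.of_forall fun y => ?_
      rw [norm_mul]
      have h1 : ‖z n y l‖ ≤ ‖z n y‖ := by
        exact PiLp.norm_apply_le (z n y) l
      exact mul_le_mul_of_nonneg_right (h1.trans (hn y)) (norm_nonneg _)
    · exact (hφ.norm.const_mul 2)
    · refine Eventually.of_forall fun y => ?_
      have hc : Tendsto (fun n => z n y l) atTop (𝓝 (v y l)) :=
        ((EuclideanSpace.proj l).continuous.tendsto (v y)).comp (hpt y)
      exact hc.mul_const (φ y)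
  have habs : Tendsto (fun n => |∫ y, z n y l * φ y|) atTop (𝓝 |∫ y, v y l * φ y|) :=
    (continuous_abs.tendsto _).comp hlim
  exact le_of_tendsto habs (by
    filter_upwards [hPMn] with n hn
    exact hn l φ hφ hJ)

/-! ### Registered form -/

/-- **Registered sub-goal `pm_dual_of_envelope`** (explicit restatement of
`abs_integral_synthVel_mul_le`): a pointwise critical Fourier envelope `‖ξ‖² ‖f ξ‖ ≤ C` of a
continuous coefficient field with decay of every order gives the dual `PM²` bound
`|∫ (synthVel f)_l φ| ≤ C ∫ ‖𝓕φ‖/‖ξ‖²` for every admissible real test function `φ`. [folklore] -/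
theorem pm_dual_of_envelope :
    ∀ (C : ℝ) (f : EuclideanSpace ℝ (Fin 3) → Fin 3 → ℂ), Continuous f →
      (∀ K : ℕ, ∃ B : ℝ, Literature.Analysis.FluidPDE.FourierNS.HasDecay K B f) →
      (∀ ξ : EuclideanSpace ℝ (Fin 3), ‖ξ‖ ^ 2 * ‖f ξ‖ ≤ C) →
      ∀ (l : Fin 3) (φ : EuclideanSpace ℝ (Fin 3) → ℝ), MeasureTheory.Integrable φ →
        MeasureTheory.Integrable (fun ξ : EuclideanSpace ℝ (Fin 3) =>
          ‖FourierTransform.fourier (fun x => (φ x : ℂ)) ξ‖ / ‖ξ‖ ^ 2) →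
        |∫ x, Literature.Analysis.FluidPDE.FourierNS.synthVel f x l * φ x| ≤
          C * ∫ ξ : EuclideanSpace ℝ (Fin 3), ‖FourierTransform.fourier (fun x => (φ x : ℂ)) ξ‖ / ‖ξ‖ ^ 2 :=
  fun _ _ hf hdec henv l _ hφ hJ => abs_integral_synthVel_mul_le hf hdec henv l hφ hJ

end Summit.NavierStokesRegularity.NavierStokesRegularity.Theorems.BoundedEnvelope

end
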